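import Summits.NavierStokesRegularity.NavierStokesRegularity.Theorems.ScaledTopAlignmentTypeIBlowupBudgetPortrait
import Summits.NavierStokesRegularity.NavierStokesRegularity.Theorems.IsobarTomographyTubeAlternativeStubTwoSidedVorticityRate
import HarnessLib

/-!
# Route `ScaledTopAlignment`, crux W3ᵐᵗ = `AprioriMostTimesBulkAlignment` (stmt-NavierStokesRegularity-19551),
# registered line `nearmax` (open stub `stub_nearMaxMostTimes`): SELECTION of δ-good rate points from the
# near-max window-coherence law UDW of the cell planner (the remaining half of glue stub G1 of LAW-M)

The cell planner's BUDGET-currency law (nsreg-p3, `split-9/Split9.lean` rev 7 / `round-10/Law10-rev2.lean`,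
`UniversalNearMaxWindowCoherence δ θ λ₀ R₀ A`, law form UDW∞ = `∀ δ ∃ A`) says, for ONE classical Leray–Hopf
flow `u` from a rapidly decaying datum with `‖curl u₀‖ ≤ m₀`: on every `[0, T']`, `T' < T`, the saturation mass
`∬ |ω|^{5/2}/ν` of the `A·m₀`-AMPLIFIED, `λ₀`-NEAR-MAXIMAL (`λ₀ sup|ω(t)| ≤ |ω(t,x)|`) points whose near-max window
`S(t,x) = {λ₀|ω(t,x)| ≤ |ω|, |y − x| ≤ R₀√(ν/|ω(t,x)|)}` is MORE than `δ`-decoherent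
(`δ·∫_S|ω|^{5/2}/ν < ∫_S|ω|^{3/2}‖∇ξ‖²`) is at most `θ < 1` times the saturation mass of all amplified near-maximal
points. The glue stub G1 `stub_alignedProfile_of_lawM` of the planner's LAW-M package needs, at a Type-I
singular time, LATE rate points whose window is `δ`-GOOD (`budget ≤ δ·sat`). This file proves that selection:

* `exists_goodRatePoint_of_nearMaxWindowCoherence` — for a classical Leray–Hopf solution from a rapidly
  decaying datum with the Type-I rate at `T` and NO smooth extension past `T`, and `0 < λ₀ < 1`: there is a
  rate floor `κ > 0` (`κ = λ₀ c`, `c` the lower Type-I vorticity rate `lower_vorticity_rate`) such that for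
  every law instance (`δ`, `θ < 1`, `R₀`, `A > 0`, quantified over all datum bounds `m₀`) and every `t₁ < T`
  some point `(t, x)`, `t ∈ [t₁, T)`, has `κ/(T − t) ≤ |ω(t,x)|` and a `δ`-good window.
  Proof. INFLATE the datum bound: the law holds for every `m ≥ m₀`, and for `m` large the gate `A·m` exceeds
  `sup|ω|` on `[0, t₂]` (`t₂ ≥ t₁` late; Tao's bounded Sobolev norms on the closed slab), so amplified points
  are automatically late; at late near-maximal points the LOWER vorticity rate gives the floor
  `λ₀ c/(T − t) ≤ |ω|` (the slice supremum is a true supremum by the UPPER rate `upper_vorticity_rate`). If no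
  late rate point were good, the total amplified near-max mass `X` on `[0, T']` would equal its bad part, so the
  law gives `X ≤ θ X`; but `X < ∞` (Tao class on `[0,T']`: `|ω| ≤ Ω'`, `∫|ω|² ≤ ‖curl‖²∫‖Du‖²`) and `X > 0`
  (every very late slice has an OPEN non-empty set of amplified near-maximal points — `exists_lt_of_lt_ciSup` —
  and the slice masses are a.e.-measurable in `t`: the slice supremum is the supremum over a dense SEQUENCE,
  `ciSup_eq_ciSup_denseSeq`, then Tonelli `AEMeasurable.lintegral_prod_right'`) — absurd.

With the flow-side portrait `typeI_uniform_window_budget_decoherence` (`ScaledTopAlignmentTypeIBlowupBudgetPortrait`)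
this closes the planner's LAW-M package: UDW∞ ⇒ `ThreadingFlux.Target` (sibling glue file
`ScaledTopAlignmentAprioriMostTimesBulkAlignmentNearMaxOfUniversalLaws`). WHAT THIS IS NOT: not NS regularity, not
a proof of the law or of the stub; a selection lemma about hypothetical Type-I singular flows. [folklore]

## References
* Koch–Nadirashvili–Seregin–Šverák, Acta Math. 203 (2009) = arXiv:0709.3599, Prop. 4.1, Lemma 6.1. [KochNadirashviliSereginSverak2009]
* T. Tao, Anal. PDE 6 (2013), Cor. 11.1 (bounded Sobolev norms on closed slabs). [Tao2011]
-/

noncomputable section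

-- the summit and its single sub-problem share the name (CONVENTIONS §1), as in every Theorems file
set_option linter.dupNamespace false

open Set Function Filter Topology Metric MeasureTheory TopologicalSpace
open scoped RealInnerProductSpace ENNReal NNReal
open Literature.Analysis Literature.Analysis.FluidPDE

namespace Summit.NavierStokesRegularity.NavierStokesRegularity.Theorems

/-! ### Tools: suprema over a dense sequence, open positive slices, an elementary power bound -/

/-- The supremum of a continuous function bounded above on `ℝ³` is its supremum over the canonical dense
sequence (so that slice suprema of jointly continuous fields are measurable in the parameter). [folklore] -/
theorem ciSup_eq_ciSup_denseSeq {f : EuclideanSpace ℝ (Fin 3) → ℝ} (hf : Continuous f)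
    (hbdd : BddAbove (range f)) :
    ⨆ z, f z = ⨆ n : ℕ, f (denseSeq (EuclideanSpace ℝ (Fin 3)) n) := by
  have hbdd' : BddAbove (range fun n : ℕ => f (denseSeq (EuclideanSpace ℝ (Fin 3)) n)) :=
    hbdd.mono (by rintro _ ⟨n, rfl⟩; exact ⟨_, rfl⟩)
  refine le_antisymm (ciSup_le fun z => ?_) (ciSup_le fun n => le_ciSup hbdd _)
  have hz : z ∈ closure (range (denseSeq (EuclideanSpace ℝ (Fin 3)))) := by
    rw [(denseRange_denseSeq (EuclideanSpace ℝ (Fin 3))).closure_range]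
    exact mem_univ z
  obtain ⟨x, hx, hxz⟩ := mem_closure_iff_seq_limit.1 hz
  have hlim : Tendsto (fun k => f (x k)) atTop (𝓝 (f z)) := (hf.tendsto z).comp hxz
  refine le_of_tendsto' hlim fun k => ?_
  obtain ⟨n, hn⟩ := hx k
  rw [← hn]
  exact le_ciSup hbdd' n

/-- `x^{5/2} ≤ M^{1/2} x²` for `0 ≤ x ≤ M`. [folklore] -/
theorem rpow_five_halves_le {x M : ℝ} (hx : 0 ≤ x) (hxM : x ≤ M) :
    x ^ (5 / 2 : ℝ) ≤ M ^ (1 / 2 : ℝ) * x ^ 2 := by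
  have e : x ^ (5 / 2 : ℝ) = x ^ (1 / 2 : ℝ) * x ^ 2 := by
    rw [show (5 / 2 : ℝ) = 1 / 2 + 2 by norm_num, Real.rpow_add' hx (by norm_num), Real.rpow_two]
  rw [e]
  exact mul_le_mul_of_nonneg_right (Real.rpow_le_rpow hx hxM (by norm_num)) (sq_nonneg _)

/-- The slice enstrophy is controlled by the `H¹` seminorm: `∫ ofReal(‖curl v‖²) ≤ ‖curlCLM‖² ∫ ‖D¹v‖ₑ²`
(`‖curl v x‖ ≤ ‖curlCLM‖ ‖Dv(x)‖`, `‖D¹v‖ = ‖Dv‖`). [folklore] -/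
theorem lintegral_curl_sq_le (v : EuclideanSpace ℝ (Fin 3) → EuclideanSpace ℝ (Fin 3)) :
    ∫⁻ x, ENNReal.ofReal (‖curl v x‖ ^ 2) ≤
      ENNReal.ofReal (‖curlCLM‖ ^ 2) * ∫⁻ x, ‖iteratedFDeriv ℝ 1 v x‖ₑ ^ 2 := by
  rw [← lintegral_const_mul' _ _ ENNReal.ofReal_ne_top]
  refine lintegral_mono fun x => ?_
  rw [← ofReal_norm, norm_iteratedFDeriv_one, ← ENNReal.ofReal_pow (norm_nonneg _),
    ← ENNReal.ofReal_mul (sq_nonneg _), ← mul_pow]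
  exact ENNReal.ofReal_le_ofReal (pow_le_pow_left₀ (norm_nonneg _) (norm_curl_le v x) 2)

/-! ### The selection theorem -/

/-- **Selection of δ-good rate points from the near-max window-coherence law.** Let `(u, p)` be a classical
solution (`ν > 0`) on `ℝ³ × [0, T)`, Leray–Hopf from its rapidly decaying datum, with the Type-I rate at `T`
and no smooth extension past `T`, and let `0 < λ₀ < 1`. Then there is `κ > 0` such that: whenever the planner's
law instance UDW(δ, θ, λ₀, R₀, A) holds for this solution for all datum bounds `m₀` (`θ < 1`, `A > 0`) — bad
(more-than-`δ`-decoherent) amplified near-max saturation mass `≤ θ ×` total amplified near-max saturation mass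
on every `[0, T']` — then for every `t₁ ∈ [0, T)` some `(t, x)`, `t ∈ [t₁, T)`, has `κ/(T − t) ≤ |ω(t,x)|` and a
`δ`-GOOD window `∫_S |ω|^{3/2}‖∇ξ‖² ≤ δ · ∫_S |ω|^{5/2}/ν`. Datum-bound inflation, Tao's slab bounds, the
two-sided Type-I vorticity rate and a Tonelli positivity argument (module docstring).
[cite: KochNadirashviliSereginSverak2009, Prop. 4.1 and Lemma 6.1 (arXiv:0709.3599 pp. 8, 11); Tao2011, Cor. 11.1] -/
theorem exists_goodRatePoint_of_nearMaxWindowCoherence {ν T : ℝ} (hν : 0 < ν) (hT : 0 < T)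
    {u : ℝ → EuclideanSpace ℝ (Fin 3) → EuclideanSpace ℝ (Fin 3)} {p : ℝ → EuclideanSpace ℝ (Fin 3) → ℝ}
    (hsol : IsClassicalNSSolutionOn (Ico 0 T) ν 0 u p) (hLH : IsLerayHopfOn T ν 0 (u 0) u)
    (hdec : HasRapidSpatialDecay (u 0)) (hI : IsTypeIBlowup u T) (hext : ¬ HasSmoothExtensionPast ν 0 u T)
    {lam0 : ℝ} (hlam0 : 0 < lam0) (hlam1 : lam0 < 1) :
    ∃ κ : ℝ, 0 < κ ∧ ∀ (δ θ R0 A : ℝ), θ < 1 → 0 < A →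
      (∀ m0 : ℝ, 0 < m0 → (∀ x, ‖curl (u 0) x‖ ≤ m0) → ∀ T' : ℝ, 0 < T' → T' < T →
        (∫⁻ t in Icc 0 T', ∫⁻ x in {x : EuclideanSpace ℝ (Fin 3) |
            lam0 * (⨆ z, ‖curl (u t) z‖) ≤ ‖curl (u t) x‖ ∧ A * m0 ≤ ‖curl (u t) x‖ ∧
            ENNReal.ofReal δ *
                (∫⁻ y in {y : EuclideanSpace ℝ (Fin 3) | lam0 * ‖curl (u t) x‖ ≤ ‖curl (u t) y‖ ∧
                    ‖y - x‖ ≤ R0 * Real.sqrt (ν / ‖curl (u t) x‖)},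
                  ENNReal.ofReal (‖curl (u t) y‖ ^ (5 / 2 : ℝ) / ν)) <
              ∫⁻ y in {y : EuclideanSpace ℝ (Fin 3) | lam0 * ‖curl (u t) x‖ ≤ ‖curl (u t) y‖ ∧
                  ‖y - x‖ ≤ R0 * Real.sqrt (ν / ‖curl (u t) x‖)},
                ENNReal.ofReal (‖curl (u t) y‖ ^ (3 / 2 : ℝ) *
                  ‖fderiv ℝ (vorticityDirection (curl (u t))) y‖ ^ 2)},
            ENNReal.ofReal (‖curl (u t) x‖ ^ (5 / 2 : ℝ) / ν)) ≤
        ENNReal.ofReal θ *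
          ∫⁻ t in Icc 0 T', ∫⁻ x in {x : EuclideanSpace ℝ (Fin 3) |
              lam0 * (⨆ z, ‖curl (u t) z‖) ≤ ‖curl (u t) x‖ ∧ A * m0 ≤ ‖curl (u t) x‖},
            ENNReal.ofReal (‖curl (u t) x‖ ^ (5 / 2 : ℝ) / ν)) →
      ∀ t₁ ∈ Ico 0 T, ∃ t ∈ Ico t₁ T, ∃ x : EuclideanSpace ℝ (Fin 3),
        κ / (T - t) ≤ ‖curl (u t) x‖ ∧
        (∫⁻ y in {y : EuclideanSpace ℝ (Fin 3) | lam0 * ‖curl (u t) x‖ ≤ ‖curl (u t) y‖ ∧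
              ‖y - x‖ ≤ R0 * Real.sqrt (ν / ‖curl (u t) x‖)},
            ENNReal.ofReal (‖curl (u t) y‖ ^ (3 / 2 : ℝ) *
              ‖fderiv ℝ (vorticityDirection (curl (u t))) y‖ ^ 2)) ≤
          ENNReal.ofReal δ *
            ∫⁻ y in {y : EuclideanSpace ℝ (Fin 3) | lam0 * ‖curl (u t) x‖ ≤ ‖curl (u t) y‖ ∧
                ‖y - x‖ ≤ R0 * Real.sqrt (ν / ‖curl (u t) x‖)},
              ENNReal.ofReal (‖curl (u t) y‖ ^ (5 / 2 : ℝ) / ν) := by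
  -- ## the two-sided Type-I vorticity rate; the rate floor `κ = λ₀ c`
  obtain ⟨Cω, tω, htω, hup⟩ := TubeAlternative.AnalyticPropagation.upper_vorticity_rate hν hT hsol hLH hdec hI
  obtain ⟨c, hc, tc, htc, hlow⟩ :=
    TubeAlternative.AnalyticPropagation.lower_vorticity_rate hν hT ⟨hsol, hext⟩ hLH hdec hI
  refine ⟨lam0 * c, by positivity, ?_⟩
  intro δ θ R0 A hθ hA hlaw t₁ ht₁
  by_contra hno
  push Not at hno
  -- abbreviations: vorticity size, window saturation / budget, slice supremum
  set ω : ℝ → EuclideanSpace ℝ (Fin 3) → ℝ := fun t x => ‖curl (u t) x‖ with hω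
  have hωc : ContinuousOn (fun z : ℝ × EuclideanSpace ℝ (Fin 3) => ω z.1 z.2) (Ico 0 T ×ˢ univ) := by
    have h := IsSmoothSpaceTimeOn.continuousOn_fderiv_slice hsol.smooth_velocity (uniqueDiffOn_Ico 0 T)
    exact (curlCLM.continuous.comp_continuousOn h).norm
  have hωsl : ∀ t ∈ Ico 0 T, Continuous (ω t) := fun t ht =>
    (contDiff_curl (n := ⊤) (by exact_mod_cast hsol.contDiff_velocity ht)).continuous.norm
  -- late slices: bounded above, with a point at the lower rate
  have hbdd : ∀ t ∈ Ico tω T, BddAbove (range (ω t)) := fun t ht =>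
    ⟨Cω / (T - t), by rintro _ ⟨z, rfl⟩; exact hup t ht z⟩
  have hsup_ge : ∀ t ∈ Ico tω T, t ∈ Ico tc T → c / (T - t) ≤ ⨆ z, ω t z := by
    intro t ht ht'
    obtain ⟨x, hx⟩ := hlow t ht'
    have h2 : ω t x ≤ ⨆ z, ω t z := le_ciSup (hbdd t ht) x
    exact le_trans hx h2
  -- ## a late base time `t₂ ≥ t₁, tω, tc, T/2` and the early vorticity bound on `[0, t₂]`
  set t₂ : ℝ := max (max (max t₁ tω) tc) (T / 2) with ht₂
  have ht₂T : t₂ < T := max_lt (max_lt (max_lt ht₁.2 htω.2) htc.2) (by linarith)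
  have ht₂0 : 0 < t₂ := lt_of_lt_of_le (by linarith) (le_max_right _ _)
  have ht₁₂ : t₁ ≤ t₂ := ((le_max_left _ _).trans (le_max_left _ _)).trans (le_max_left _ _)
  have htω₂ : tω ≤ t₂ := ((le_max_right _ _).trans (le_max_left _ _)).trans (le_max_left _ _)
  have htc₂ : tc ≤ t₂ := (le_max_right _ _).trans (le_max_left _ _)
  obtain ⟨B₁, -, hB₁⟩ := iteratedFDeriv_slab_bound_of_lerayHopf hν hsol hLH hdec ⟨ht₂0, ht₂T⟩ 1
  set Ω₂ : ℝ := ‖curlCLM‖ * B₁ with hΩ₂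
  have hΩ₂b : ∀ t ∈ Icc 0 t₂, ∀ x, ω t x ≤ Ω₂ := fun t ht x => by
    have h1 : ‖fderiv ℝ (u t) x‖ ≤ B₁ := by rw [← norm_iteratedFDeriv_one]; exact hB₁ t ht x
    exact (norm_curl_le _ _).trans (mul_le_mul_of_nonneg_left h1 (norm_nonneg curlCLM))
  -- ## inflate the datum bound so that the gate `A m` exceeds `Ω₂ + 1`
  obtain ⟨m00, hm00, hbd0⟩ : ∃ m0 : ℝ, 0 < m0 ∧ ∀ x, ‖curl (u 0) x‖ ≤ m0 := by
    obtain ⟨C, hC⟩ := hdec 1 0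
    refine ⟨max 1 (‖curlCLM‖ * C), lt_of_lt_of_le one_pos (le_max_left _ _), fun x => ?_⟩
    have h1 : ‖iteratedFDeriv ℝ 1 (u 0) x‖ ≤ C := by simpa using hC x
    have h2 : ‖fderiv ℝ (u 0) x‖ ≤ C := by rw [← norm_iteratedFDeriv_one]; exact h1
    exact ((norm_curl_le _ _).trans (mul_le_mul_of_nonneg_left h2 (norm_nonneg curlCLM))).trans
      (le_max_right _ _)
  set m : ℝ := max m00 ((|Ω₂| + 1) / A) with hm
  have hm0 : 0 < m := lt_of_lt_of_le hm00 (le_max_left _ _)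
  have hbd : ∀ x, ‖curl (u 0) x‖ ≤ m := fun x => (hbd0 x).trans (le_max_left _ _)
  have hAm : |Ω₂| + 1 ≤ A * m := by
    have : A * ((|Ω₂| + 1) / A) = |Ω₂| + 1 := by field_simp
    rw [← this]
    exact mul_le_mul_of_nonneg_left (le_max_right _ _) hA.le
  have hAm0 : 0 < A * m := by positivity
  -- ## a very late time `t₃ ≥ t₂` after which the rate floor beats the gate, and the horizon `T'`
  set t₃ : ℝ := max t₂ (T - lam0 * c / (2 * (A * m))) with ht₃
  have hq0 : 0 < lam0 * c / (2 * (A * m)) := by positivity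
  have ht₃T : t₃ < T := max_lt ht₂T (by linarith)
  have ht₂₃ : t₂ ≤ t₃ := le_max_left _ _
  have hgate : ∀ t, t₃ < t → t < T → A * m < lam0 * c / (T - t) := fun t h3 hT' => by
    have hTt : 0 < T - t := sub_pos.2 hT'
    have h1 : T - t < lam0 * c / (2 * (A * m)) := by
      have := le_max_right t₂ (T - lam0 * c / (2 * (A * m))); rw [← ht₃] at this; linarith
    rw [lt_div_iff₀ hTt]
    have h2 : A * m * (T - t) < A * m * (lam0 * c / (2 * (A * m))) := mul_lt_mul_of_pos_left h1 hAm0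
    have h3 : A * m * (lam0 * c / (2 * (A * m))) = lam0 * c / 2 := by field_simp
    have h4 : 0 < lam0 * c := by positivity
    linarith
  set T' : ℝ := (t₃ + T) / 2 with hT'
  have hT'T : T' < T := by rw [hT']; linarith
  have ht₃T' : t₃ < T' := by rw [hT']; linarith
  have hT'0 : 0 < T' := ht₂0.trans_le (ht₂₃.trans ht₃T'.le)
  -- ## the law at `(m, T')`
  have hL := hlaw m hm0 hbd T' hT'0 hT'T
  set SAT : ℝ → EuclideanSpace ℝ (Fin 3) → ℝ≥0∞ := fun t x =>
    ∫⁻ y in {y : EuclideanSpace ℝ (Fin 3) | lam0 * ‖curl (u t) x‖ ≤ ‖curl (u t) y‖ ∧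
        ‖y - x‖ ≤ R0 * Real.sqrt (ν / ‖curl (u t) x‖)}, ENNReal.ofReal (‖curl (u t) y‖ ^ (5 / 2 : ℝ) / ν)
    with hSAT
  set BUD : ℝ → EuclideanSpace ℝ (Fin 3) → ℝ≥0∞ := fun t x =>
    ∫⁻ y in {y : EuclideanSpace ℝ (Fin 3) | lam0 * ‖curl (u t) x‖ ≤ ‖curl (u t) y‖ ∧
        ‖y - x‖ ≤ R0 * Real.sqrt (ν / ‖curl (u t) x‖)},
      ENNReal.ofReal (‖curl (u t) y‖ ^ (3 / 2 : ℝ) * ‖fderiv ℝ (vorticityDirection (curl (u t))) y‖ ^ 2)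
    with hBUD
  set sat : ℝ → EuclideanSpace ℝ (Fin 3) → ℝ≥0∞ := fun t x => ENNReal.ofReal (ω t x ^ (5 / 2 : ℝ) / ν) with hsat
  set tot : ℝ → Set (EuclideanSpace ℝ (Fin 3)) := fun t =>
    {x | lam0 * (⨆ z, ω t z) ≤ ω t x ∧ A * m ≤ ω t x} with htot
  set bad : ℝ → Set (EuclideanSpace ℝ (Fin 3)) := fun t =>
    {x | lam0 * (⨆ z, ω t z) ≤ ω t x ∧ A * m ≤ ω t x ∧ ENNReal.ofReal δ * SAT t x < BUD t x} with hbad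
  have hL' : ∫⁻ t in Icc 0 T', ∫⁻ x in bad t, sat t x ≤
      ENNReal.ofReal θ * ∫⁻ t in Icc 0 T', ∫⁻ x in tot t, sat t x := hL
  -- ## early slices carry no amplified point; late amplified near-max points are rate points, hence bad
  have hearly : ∀ t ∈ Icc 0 t₂, tot t = ∅ := fun t ht => by
    refine eq_empty_iff_forall_notMem.2 fun x hx => ?_
    have h1 := hΩ₂b t ht x
    have h2 : Ω₂ ≤ |Ω₂| := le_abs_self _
    linarith [hx.2]
  have hrate : ∀ t, t₂ < t → t < T → ∀ x ∈ tot t, lam0 * c / (T - t) ≤ ω t x := fun t h2 hT' x hx => by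
    have htI : t ∈ Ico tω T := ⟨htω₂.trans h2.le, hT'⟩
    have h := hsup_ge t htI ⟨htc₂.trans h2.le, hT'⟩
    calc lam0 * c / (T - t) = lam0 * (c / (T - t)) := by ring
      _ ≤ lam0 * ⨆ z, ω t z := mul_le_mul_of_nonneg_left h hlam0.le
      _ ≤ ω t x := hx.1
  have hlate : ∀ t, t₂ < t → t < T → tot t ⊆ bad t := fun t h2 hT' x hx =>
    ⟨hx.1, hx.2, hno t ⟨(ht₁₂.trans_lt h2).le, hT'⟩ x (hrate t h2 hT' x hx)⟩
  -- ## hence total ≤ bad ≤ θ · total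
  have htot_le : ∫⁻ t in Icc 0 T', ∫⁻ x in tot t, sat t x ≤ ∫⁻ t in Icc 0 T', ∫⁻ x in bad t, sat t x := by
    refine lintegral_mono_ae ((ae_restrict_iff' measurableSet_Icc).2 (ae_of_all _ fun t ht => ?_))
    rcases le_or_gt t t₂ with h | h
    · rw [hearly t ⟨ht.1, h⟩]
      simp
    · exact lintegral_mono_set (hlate t h (ht.2.trans_lt hT'T))
  set X : ℝ≥0∞ := ∫⁻ t in Icc 0 T', ∫⁻ x in tot t, sat t x with hX
  have hXθ : X ≤ ENNReal.ofReal θ * X := htot_le.trans hL'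
  -- ## `X < ∞`: Tao's class on the closed slab `[0, T']`
  have hsolc : IsClassicalNSSolutionOn (Icc 0 T') ν 0 u p :=
    hsol.mono (Icc_subset_Ico_right hT'T) (uniqueDiffOn_Icc hT'0)
  have hE : ∃ C : ℝ≥0, ∀ t ∈ Icc 0 T', ∫⁻ x, ‖u t x‖ₑ ^ 2 ≤ C :=
    ⟨(2 * VectorCalculus.kineticEnergy (u 0)).toNNReal, fun t ht =>
      hLH.lintegral_enorm_sq_le hν.le ⟨ht.1, ht.2.trans hT'T.le⟩⟩
  have hBS : HasBoundedSobolevNormsOn (Icc 0 T') u :=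
    tao2011_hasBoundedSobolevNormsOn_holds hν hT'0 hsolc hE hdec
  obtain ⟨C₁, hC₁⟩ := hBS 1
  obtain ⟨B', -, hB'⟩ := hBS.exists_forall_norm_iteratedFDeriv_le (fun t ht => hsolc.contDiff_velocity ht) 1
  set Ω' : ℝ := ‖curlCLM‖ * B' with hΩ'
  have hΩ'b : ∀ t ∈ Icc 0 T', ∀ x, ω t x ≤ Ω' := fun t ht x => by
    have h1 : ‖fderiv ℝ (u t) x‖ ≤ B' := by rw [← norm_iteratedFDeriv_one]; exact hB' t ht x
    exact (norm_curl_le _ _).trans (mul_le_mul_of_nonneg_left h1 (norm_nonneg curlCLM))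
  have hΩ'0 : 0 ≤ Ω' := (norm_nonneg _).trans (hΩ'b 0 ⟨le_rfl, hT'0.le⟩ 0)
  set K : ℝ≥0∞ := ENNReal.ofReal (Ω' ^ (1 / 2 : ℝ) / ν) * (ENNReal.ofReal (‖curlCLM‖ ^ 2) * C₁) with hK
  have hKtop : K ≠ ⊤ := ENNReal.mul_ne_top ENNReal.ofReal_ne_top
    (ENNReal.mul_ne_top ENNReal.ofReal_ne_top ENNReal.coe_ne_top)
  have hslice_le : ∀ t ∈ Icc 0 T', ∫⁻ x in tot t, sat t x ≤ K := fun t ht => by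
    calc ∫⁻ x in tot t, sat t x ≤ ∫⁻ x, sat t x := setLIntegral_le_lintegral _ _
      _ ≤ ∫⁻ x, ENNReal.ofReal (Ω' ^ (1 / 2 : ℝ) / ν) * ENNReal.ofReal (‖curl (u t) x‖ ^ 2) := by
          refine lintegral_mono fun x => ?_
          simp only [hsat, hω]
          rw [← ENNReal.ofReal_mul (by positivity)]
          refine ENNReal.ofReal_le_ofReal ?_
          rw [div_mul_eq_mul_div]
          exact div_le_div_of_nonneg_right (rpow_five_halves_le (norm_nonneg _) (hΩ'b t ht x)) hν.le
      _ = ENNReal.ofReal (Ω' ^ (1 / 2 : ℝ) / ν) * ∫⁻ x, ENNReal.ofReal (‖curl (u t) x‖ ^ 2) :=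
          lintegral_const_mul' _ _ ENNReal.ofReal_ne_top
      _ ≤ ENNReal.ofReal (Ω' ^ (1 / 2 : ℝ) / ν) * (ENNReal.ofReal (‖curlCLM‖ ^ 2) * C₁) := by
          refine mul_le_mul_right ((lintegral_curl_sq_le (u t)).trans ?_) _
          exact mul_le_mul_right (hC₁ t ht) _
  have hXtop : X ≠ ⊤ := by
    have h1 : X ≤ ∫⁻ t in Icc 0 T', K :=
      lintegral_mono_ae ((ae_restrict_iff' measurableSet_Icc).2 (ae_of_all _ fun t ht => hslice_le t ht))
    rw [setLIntegral_const, Real.volume_Icc] at h1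
    exact ne_top_of_le_ne_top (ENNReal.mul_ne_top hKtop ENNReal.ofReal_ne_top) h1
  -- ## `X ≠ 0`: positive, a.e.-measurable slice masses on the very late window `(t₃, T')`
  -- the slice supremum as a supremum over the dense sequence (late slices)
  set g : ℝ → ℝ := fun t => ⨆ n : ℕ, ω t (denseSeq (EuclideanSpace ℝ (Fin 3)) n) with hg
  have hg_eq : ∀ t ∈ Ico tω T, ⨆ z, ω t z = g t := fun t ht =>
    ciSup_eq_ciSup_denseSeq (hωsl t ⟨htω.1.trans ht.1, ht.2⟩) (hbdd t ht)
  have hIoo_sub : Ioo t₃ T' ⊆ Ico 0 T := fun t ht =>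
    ⟨(ht₂0.le.trans ht₂₃).trans ht.1.le, ht.2.trans hT'T⟩
  have hIoo_late : ∀ t ∈ Ioo t₃ T', t ∈ Ico tω T := fun t ht =>
    ⟨(htω₂.trans ht₂₃).trans ht.1.le, ht.2.trans hT'T⟩
  -- the space–time density of the total mass, on the restricted product measure
  set H : ℝ × EuclideanSpace ℝ (Fin 3) → ℝ≥0∞ := fun q =>
    {q : ℝ × EuclideanSpace ℝ (Fin 3) | lam0 * g q.1 ≤ ω q.1 q.2 ∧ A * m ≤ ω q.1 q.2}.indicator
      (fun q => ENNReal.ofReal (ω q.1 q.2 ^ (5 / 2 : ℝ) / ν)) q with hH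
  have hprod : ((volume : Measure ℝ).restrict (Ioo t₃ T')).prod (volume : Measure (EuclideanSpace ℝ (Fin 3))) =
      ((volume : Measure ℝ).prod (volume : Measure (EuclideanSpace ℝ (Fin 3)))).restrict (Ioo t₃ T' ×ˢ univ) := by
    rw [← Measure.restrict_univ (μ := (volume : Measure (EuclideanSpace ℝ (Fin 3)))), Measure.prod_restrict,
      Measure.restrict_univ]
  have hωae : AEMeasurable (fun q : ℝ × EuclideanSpace ℝ (Fin 3) => ω q.1 q.2)
      (((volume : Measure ℝ).restrict (Ioo t₃ T')).prod volume) := by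
    rw [hprod]
    exact (hωc.mono (prod_mono hIoo_sub subset_rfl)).aemeasurable (measurableSet_Ioo.prod MeasurableSet.univ)
  have hgae : AEMeasurable (fun q : ℝ × EuclideanSpace ℝ (Fin 3) => g q.1)
      (((volume : Measure ℝ).restrict (Ioo t₃ T')).prod volume) := by
    simp only [hg]
    refine AEMeasurable.iSup fun n => ?_
    rw [hprod]
    refine (ContinuousOn.aemeasurable ?_ (measurableSet_Ioo.prod MeasurableSet.univ))
    have h1 : ContinuousOn (fun q : ℝ × EuclideanSpace ℝ (Fin 3) =>
        (q.1, denseSeq (EuclideanSpace ℝ (Fin 3)) n)) (Ioo t₃ T' ×ˢ univ) :=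
      (continuous_fst.prodMk continuous_const).continuousOn
    refine (hωc.comp h1 fun q hq => ⟨hIoo_sub hq.1, mem_univ _⟩).congr fun q _ => rfl
  have hHae : AEMeasurable H (((volume : Measure ℝ).restrict (Ioo t₃ T')).prod volume) := by
    refine AEMeasurable.indicator₀ ?_ ?_
    · exact ENNReal.measurable_ofReal.comp_aemeasurable ((hωae.pow_const _).div_const _)
    · exact (nullMeasurableSet_le (hgae.const_mul _) hωae).inter (nullMeasurableSet_le aemeasurable_const hωae)
  have hΦae : AEMeasurable (fun t => ∫⁻ x, H (t, x)) ((volume : Measure ℝ).restrict (Ioo t₃ T')) :=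
    hHae.lintegral_prod_right'
  -- on late slices the density integrates to the slice mass
  have htot_meas : ∀ t ∈ Ico 0 T, MeasurableSet (tot t) := fun t ht =>
    (isClosed_le continuous_const (hωsl t ht)).measurableSet.inter
      (isClosed_le continuous_const (hωsl t ht)).measurableSet
  have hΦeq : ∀ t ∈ Ioo t₃ T', ∫⁻ x, H (t, x) = ∫⁻ x in tot t, sat t x := fun t ht => by
    have hset : {x : EuclideanSpace ℝ (Fin 3) | lam0 * g t ≤ ω t x ∧ A * m ≤ ω t x} = tot t := by
      simp only [htot, hg_eq t (hIoo_late t ht)]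
    rw [← lintegral_indicator (htot_meas t (hIoo_sub ht))]
    refine lintegral_congr fun x => ?_
    simp only [hH, hsat]
    rw [← hset]
    rfl
  -- every very late slice has positive mass: an open non-empty set of amplified near-maximal points
  have hpos : ∀ t ∈ Ioo t₃ T', 0 < ∫⁻ x in tot t, sat t x := fun t ht => by
    have htI := hIoo_sub ht
    have htl := hIoo_late t ht
    have hTt : 0 < T - t := sub_pos.2 htI.2
    set s : ℝ := ⨆ z, ω t z with hs
    have hs_ge : c / (T - t) ≤ s := hsup_ge t htl ⟨htc₂.trans (ht₂₃.trans ht.1.le), htI.2⟩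
    have hs0 : 0 < s := lt_of_lt_of_le (div_pos hc hTt) hs_ge
    have hgate' : A * m < lam0 * s := by
      have h1 := hgate t ht.1 htI.2
      have h2 : lam0 * c / (T - t) = lam0 * (c / (T - t)) := by ring
      rw [h2] at h1
      exact h1.trans_le (mul_le_mul_of_nonneg_left hs_ge hlam0.le)
    have hlt : lam0 * s < s := by nlinarith
    obtain ⟨z, hz⟩ : ∃ z, lam0 * s < ω t z := exists_lt_of_lt_ciSup hlt
    set O : Set (EuclideanSpace ℝ (Fin 3)) := {x | lam0 * s < ω t x ∧ A * m < ω t x} with hO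
    have hOo : IsOpen O :=
      (isOpen_lt continuous_const (hωsl t htI)).inter (isOpen_lt continuous_const (hωsl t htI))
    have hOne : O.Nonempty := ⟨z, hz, hgate'.trans hz⟩
    have hOsub : O ⊆ tot t := fun x hx => ⟨hx.1.le, hx.2.le⟩
    have hOvol : 0 < volume O := hOo.measure_pos volume hOne
    have hlow' : ∀ x ∈ O, ENNReal.ofReal ((A * m) ^ (5 / 2 : ℝ) / ν) ≤ sat t x := fun x hx => by
      simp only [hsat]
      exact ENNReal.ofReal_le_ofReal (div_le_div_of_nonneg_right
        (Real.rpow_le_rpow hAm0.le hx.2.le (by norm_num)) hν.le)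
    have hc0 : 0 < ENNReal.ofReal ((A * m) ^ (5 / 2 : ℝ) / ν) :=
      ENNReal.ofReal_pos.2 (div_pos (Real.rpow_pos_of_pos hAm0 _) hν)
    calc (0 : ℝ≥0∞) < ENNReal.ofReal ((A * m) ^ (5 / 2 : ℝ) / ν) * volume O :=
          ENNReal.mul_pos hc0.ne' hOvol.ne'
      _ = ∫⁻ x in O, ENNReal.ofReal ((A * m) ^ (5 / 2 : ℝ) / ν) := (setLIntegral_const _ _).symm
      _ ≤ ∫⁻ x in O, sat t x := setLIntegral_mono' hOo.measurableSet fun x hx => hlow' x hx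
      _ ≤ ∫⁻ x in tot t, sat t x := lintegral_mono_set hOsub
  have hX0 : X ≠ 0 := by
    intro hX0
    have h1 : ∫⁻ t in Ioo t₃ T', ∫⁻ x in tot t, sat t x = 0 := by
      refine le_antisymm ?_ bot_le
      calc ∫⁻ t in Ioo t₃ T', ∫⁻ x in tot t, sat t x ≤ X :=
            lintegral_mono_set (fun t ht => ⟨(ht₂0.le.trans ht₂₃).trans ht.1.le, ht.2.le⟩)
        _ = 0 := hX0
    have h2 : ∫⁻ t in Ioo t₃ T', (fun t => ∫⁻ x, H (t, x)) t = 0 := by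
      rw [← h1]
      exact setLIntegral_congr_fun measurableSet_Ioo fun t ht => hΦeq t ht
    have h3 := (lintegral_eq_zero_iff' hΦae).1 h2
    have h4 : ∀ᵐ t ∂(volume : Measure ℝ), t ∈ Ioo t₃ T' → False := by
      have h3' := (ae_restrict_iff' (μ := (volume : Measure ℝ)) measurableSet_Ioo).1 h3
      filter_upwards [h3'] with t ht htI
      have h5 : (∫⁻ x, H (t, x)) = 0 := ht htI
      rw [hΦeq t htI] at h5
      exact (hpos t htI).ne' h5
    have h5 : volume (Ioo t₃ T') = 0 := by
      rw [measure_eq_zero_iff_ae_notMem]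
      filter_upwards [h4] with t ht htI using ht htI
    rw [Real.volume_Ioo] at h5
    have : 0 < T' - t₃ := sub_pos.2 ht₃T'
    exact absurd h5 (ENNReal.ofReal_pos.2 this).ne'
  -- ## `X ≤ θ X` with `0 < X < ∞` and `θ < 1`: absurd
  have hθ1 : ENNReal.ofReal θ < 1 := ENNReal.ofReal_lt_one.2 hθ
  have hlt : ENNReal.ofReal θ * X < X := by
    calc ENNReal.ofReal θ * X = X * ENNReal.ofReal θ := mul_comm _ _
      _ < X * 1 := ENNReal.mul_lt_mul_right hX0 hXtop hθ1
      _ = X := mul_one _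
  exact absurd hXθ (not_le.2 hlt)

end Summit.NavierStokesRegularity.NavierStokesRegularity.Theorems

end
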